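import Literature.Probability.RandomPlanarGeometry.SAWExplorationRunningMax
import Literature.Probability.LatticeModels.CellDomainBoundary
import HarnessLib

/-!
# First passages of the running-maximum clock: the pasts before the passage, and polylines of
# pasts far from a point

Topic `Literature/Probability/RandomPlanarGeometry`; theorems only. A companion of
`SAWExplorationRunningMax.lean` (`SAW.exists_explorationFiltration_runningMax`: the exploration
filtration of the self-avoiding walk of a discrete domain run with the running maximum
`max_{i ≤ n} f γ i` of a prefix-determined clock, the Doob identity, the first passages `σ ≤ τ`
of two levels `s ≤ t`). In the passage of discrete martingale observables to the scaling limit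
(Duminil-Copin–Smirnov, Clay Math. Proc. 15 (2012), Lemma 6.6 and proof of Prop. 6.7;
Chelkak–Duminil-Copin–Hongler–Kemppainen–Smirnov, C. R. Math. 352 (2014), §3) one also needs to
know that the past at the first passage of level `s` is built from pasts of clock `< s`: every
earlier prefix `γ[0,i]`, `i < σ`, has `f γ i < s` (so a hypothesis controlling all pasts of clock
below a horizon controls the whole first-passage past). `exists_explorationFiltration_runningMax_lt`
is the package of the companion file with this clause added to the description of `σ` and `τ`.
The second group of lemmas is the elementary geometry used to read such a control on the
vertices of the past as a control on its polyline: the polyline of a walk of `Ω_δ` stays within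
`|δ|` of its vertices, so it avoids every point at distance `> |δ|` from the vertices
`γ_0, …, γ_n` of the past `γ[0,n]` (`notMem_range_toCurve_takeUntil_getVert`).

No definitions, no named facts.

## References

* H. Duminil-Copin, S. Smirnov, *Conformal invariance of lattice models*, Clay Math. Proc. 15
  (2012), Lemma 6.6, proof of Prop. 6.7.
* D. Chelkak, H. Duminil-Copin, C. Hongler, A. Kemppainen, S. Smirnov, C. R. Math. 352 (2014), §3.
-/

noncomputable section

open MeasureTheory Filter Set
open scoped ENNReal NNReal Classical
open Literature.Probability.LatticeModels (Site discreteDomainGraph meshPoint)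

namespace Literature.Probability.RandomPlanarGeometry.SAW

variable {Ω : Set ℂ} {δ : ℝ} {a b : Site 2}

/-! ### The exploration package with the pasts before the first passages -/

/-- **The exploration package with the running-maximum clock, first passages described with
their pasts.** On the finite space of SAWs of `Ω_δ` from `a` to `b`, let `f γ n` be a real clock
determined by the past `γ[0,n]`, with `f γ 0 ≤ θ` (`θ ≥ 0`), and `s ≤ t` two levels, `0 ≤ s`.
There are a filtration `𝒢` (generated by the pasts), a bound `M`, and `𝒢`-stopping times
`σ ≤ τ ≤ M` (first passages of the running maximum `max_{i ≤ n} f γ i` above `s`, `t`) such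
that: (i) past-determined maps are `𝒢 n`-measurable; (ii) the Doob identity `μ[X ∣ 𝒢 n] = `
cylinder average, a.e., for every finite measure; (iii) a real map is `𝒢_σ`-measurable as soon
as, on `{σ = k}`, it is determined by some past `γ[0,i]`, `i ≤ k`, of clock `f γ i ≥ s`; (iv) for
a walk whose clock exceeds a horizon `T ≥ s + θ` at some step and has one-step increments `≤ θ`
below `T`, `σ = k` with `s ≤ f γ k ≤ s + θ` AND `f γ i < s` for all `i < k`; same for `τ, t`.
[cite: DuminilCopinSmirnov2012Clay, Lemma 6.6] -/
theorem exists_explorationFiltration_runningMax_lt [Finite (DomainSAW Ω δ a b)]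
    (f : DomainSAW Ω δ a b → ℕ → ℝ)
    (hf : ∀ (γ γ' : DomainSAW Ω δ a b) (n n' : ℕ),
      (γ.walk.takeUntil (γ.walk.getVert n) (γ.walk.getVert_mem_support n)).support =
        (γ'.walk.takeUntil (γ'.walk.getVert n') (γ'.walk.getVert_mem_support n')).support →
      f γ n = f γ' n')
    {θ : ℝ} (hθ : 0 ≤ θ) (h0 : ∀ γ, f γ 0 ≤ θ) {s t : ℝ} (hs : 0 ≤ s) (hst : s ≤ t) :
    ∃ (𝒢 : Filtration ℕ (inferInstance : MeasurableSpace (DomainSAW Ω δ a b))) (M : ℕ)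
      (σ τ : DomainSAW Ω δ a b → WithTop ℕ) (hσ : IsStoppingTime 𝒢 σ),
      IsStoppingTime 𝒢 τ ∧ σ ≤ τ ∧ (∀ γ, τ γ ≤ M) ∧
      (∀ (n : ℕ) (g : DomainSAW Ω δ a b → ℝ),
        (∀ γ γ' : DomainSAW Ω δ a b,
          (γ.walk.takeUntil (γ.walk.getVert n) (γ.walk.getVert_mem_support n)).support =
            (γ'.walk.takeUntil (γ'.walk.getVert n) (γ'.walk.getVert_mem_support n)).support →
          g γ = g γ') → Measurable[𝒢 n] g) ∧
      (∀ (μ : Measure (DomainSAW Ω δ a b)) [IsFiniteMeasure μ] (X : DomainSAW Ω δ a b → ℝ)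
          (n : ℕ),
        μ[X | 𝒢 n] =ᵐ[μ] fun γ ↦
          (∫ x in {γ' : DomainSAW Ω δ a b | ∃ hw : γ.walk.getVert n ∈ γ'.walk.support,
              γ'.walk.takeUntil (γ.walk.getVert n) hw =
                γ.walk.takeUntil (γ.walk.getVert n) (γ.walk.getVert_mem_support n)}, X x ∂μ) /
            (μ {γ' : DomainSAW Ω δ a b | ∃ hw : γ.walk.getVert n ∈ γ'.walk.support,
              γ'.walk.takeUntil (γ.walk.getVert n) hw =
                γ.walk.takeUntil (γ.walk.getVert n) (γ.walk.getVert_mem_support n)}).toReal) ∧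
      (∀ g : DomainSAW Ω δ a b → ℝ,
        (∀ (k i : ℕ) (γ γ' : DomainSAW Ω δ a b), σ γ = k → i ≤ k → s ≤ f γ i →
          (γ.walk.takeUntil (γ.walk.getVert i) (γ.walk.getVert_mem_support i)).support =
            (γ'.walk.takeUntil (γ'.walk.getVert i) (γ'.walk.getVert_mem_support i)).support →
          g γ = g γ') →
        Measurable[hσ.measurableSpace] g) ∧
      (∀ (γ : DomainSAW Ω δ a b) (T : ℝ), s + θ ≤ T → (∃ k, T < f γ k) →
        (∀ k, f γ k ≤ T → f γ (k + 1) - f γ k ≤ θ) →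
        ∃ k : ℕ, σ γ = k ∧ s ≤ f γ k ∧ f γ k ≤ s + θ ∧ ∀ i < k, f γ i < s) ∧
      (∀ (γ : DomainSAW Ω δ a b) (T : ℝ), t + θ ≤ T → (∃ k, T < f γ k) →
        (∀ k, f γ k ≤ T → f γ (k + 1) - f γ k ≤ θ) →
        ∃ k : ℕ, τ γ = k ∧ t ≤ f γ k ∧ f γ k ≤ t + θ ∧ ∀ i < k, f γ i < t) := by
  -- the past-support maps; pasts are nested
  set sig : ℕ → DomainSAW Ω δ a b → List (Site 2) := fun n γ ↦
    (γ.walk.takeUntil (γ.walk.getVert n) (γ.walk.getVert_mem_support n)).support with hsig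
  have hnest : ∀ {i n : ℕ}, i ≤ n → ∀ {γ γ' : DomainSAW Ω δ a b}, sig n γ = sig n γ' →
      sig i γ = sig i γ' :=
    fun hin γ γ' h ↦ support_takeUntil_getVert_eq_of_le γ.isPath γ'.isPath hin h
  -- the running-max clock is prefix-determined
  have hcdet : ∀ (γ γ' : DomainSAW Ω δ a b) (n : ℕ), sig n γ = sig n γ' →
      partialSups (f γ) n = partialSups (f γ') n := by
    intro γ γ' n h
    have key : ∀ i ≤ n, f γ i = f γ' i := fun i hi ↦ hf γ γ' i i (hnest hi h)
    refine le_antisymm (partialSups_le _ _ _ fun i hi ↦ ?_) (partialSups_le _ _ _ fun i hi ↦ ?_)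
    · rw [key i hi]; exact le_partialSups_of_le _ hi
    · rw [← key i hi]; exact le_partialSups_of_le _ hi
  obtain ⟨𝒢, M, σ, τ, hσ, hτ, hστ, hτM, hMlen, h𝒢, hDoob, hσspec, hτspec, hσlt, -, hσmeas, hfull⟩ :=
    exists_explorationFiltration (fun (γ : DomainSAW Ω δ a b) n ↦ partialSups (f γ) n) hcdet hst
  -- every value of the clock is below the terminal running max
  have hfM : ∀ (γ : DomainSAW Ω δ a b) (k : ℕ), f γ k ≤ partialSups (f γ) M := by
    intro γ k
    rcases le_total k M with hk | hk
    · exact le_partialSups_of_le (f γ) hk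
    · have h1 : sig k γ = sig M γ := by
        simp only [hsig]
        rw [hfull γ k ((hMlen γ).trans hk), hfull γ M (hMlen γ)]
      rw [hf γ γ k M h1]
      exact le_partialSups (f γ) M
  -- first passages of the running max: the clock sits in `[L, L + θ]`, earlier pasts are `< L`
  have hpass : ∀ (L : ℝ) (ϑ : DomainSAW Ω δ a b → WithTop ℕ) (γ : DomainSAW Ω δ a b), 0 ≤ L →
      (∃ k : ℕ, ϑ γ = k ∧ k ≤ M ∧ (L ≤ partialSups (f γ) M →
        L ≤ partialSups (f γ) k ∧ ∀ j < k, partialSups (f γ) j < L)) →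
      ∀ T : ℝ, L + θ ≤ T → (∃ k, T < f γ k) → (∀ k, f γ k ≤ T → f γ (k + 1) - f γ k ≤ θ) →
      ∃ k : ℕ, ϑ γ = k ∧ L ≤ f γ k ∧ f γ k ≤ L + θ ∧ ∀ i < k, f γ i < L := by
    rintro L ϑ γ hL ⟨k, hϑk, -, hspec⟩ T hLT ⟨k₀, hk₀⟩ hincr
    obtain ⟨hLk, hbefore⟩ := hspec (by linarith [hfM γ k₀])
    have hlt : ∀ i < k, f γ i < L := fun i hi ↦ (le_partialSups (f γ) i).trans_lt (hbefore i hi)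
    -- the running max at the first passage is realised by the last past
    obtain ⟨j, hjk, hcj⟩ := exists_partialSups_eq (f γ) k
    have hjk' : j = k := by
      by_contra hne
      have h1 := hlt j (lt_of_le_of_ne hjk hne)
      linarith
    subst hjk'
    refine ⟨j, hϑk, hcj ▸ hLk, ?_, hlt⟩
    -- no overshoot: the previous past has clock `< L ≤ T`
    rcases j with _ | i
    · linarith [h0 γ]
    · have hi : f γ i < L := hlt i (Nat.lt_succ_self i)
      have := hincr i (by linarith)
      linarith
  refine ⟨𝒢, M, σ, τ, hσ, hτ, hστ, hτM, h𝒢, hDoob, fun g hg ↦ hσmeas g fun k γ γ' hk hkM h ↦ ?_,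
    fun γ T ↦ hpass s σ γ hs (hσspec γ) T, fun γ T ↦ hpass t τ γ (hs.trans hst) (hτspec γ) T⟩
  -- measurability for `𝒢_σ`: on `{σ = k < M}` some past `γ[0,i]`, `i ≤ k`, has clock `≥ s`
  obtain ⟨i, hik, hci⟩ := exists_partialSups_eq (f γ) k
  exact hg k i γ γ' hk hik (hci ▸ hσlt γ k hk hkM) (hnest hik h)

/-! ### The polyline of a past avoids points far from its vertices -/

/-- Mesh points of adjacent sites of `Ω_δ` are at distance `|δ|`. [folklore] -/
theorem dist_meshPoint_of_discreteDomainGraph_adj {x y : Site 2}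
    (h : (discreteDomainGraph Ω δ).Adj x y) : dist (meshPoint δ x) (meshPoint δ y) = |δ| := by
  have h' := LatticeModels.meshPoint_sub_meshPoint_of_adj δ
    (LatticeModels.meshGraph_le_zdGraph Ω δ (LatticeModels.discreteDomainGraph_le_meshGraph Ω δ h))
  rw [dist_comm, Complex.dist_eq, Complex.norm_def, Complex.normSq_apply]
  rcases h' with ⟨h0, h1⟩ | ⟨h0, h1⟩ | ⟨h0, h1⟩ | ⟨h0, h1⟩ <;>
    simp [h0, h1, ← sq, Real.sqrt_sq_eq_abs]

/-- The trace of the curve of a trivial walk of `Ω_δ` is its mesh point. [folklore] -/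
theorem range_toCurve_meshPoint_nil (u : Site 2) :
    range (((SimpleGraph.Walk.nil : (discreteDomainGraph Ω δ).Walk u u)).toCurve (meshPoint δ)) =
      {meshPoint δ u} := by
  simp [SimpleGraph.Walk.toCurve, LatticeModels.polyline]

/-- The trace of the curve of `cons h p` is the first segment followed by the trace of the curve
of `p`. [folklore] -/
theorem range_toCurve_meshPoint_cons {u v w : Site 2} (h : (discreteDomainGraph Ω δ).Adj u v)
    (p : (discreteDomainGraph Ω δ).Walk v w) :
    range ((SimpleGraph.Walk.cons h p).toCurve (meshPoint δ)) =
      segment ℝ (meshPoint δ u) (meshPoint δ v) ∪ range (p.toCurve (meshPoint δ)) := by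
  cases p <;> simp [SimpleGraph.Walk.toCurve, LatticeModels.polyline, Path.trans_range,
    Path.range_segment]

/-- **The polyline of a walk of `Ω_δ` stays within `|δ|` of its vertices**: every point of the
trace is within `|δ|` of the mesh point of some support vertex (each segment lies in the closed
`|δ|`-ball about its first endpoint). [folklore] -/
theorem exists_mem_support_dist_le_of_mem_range_toCurve :
    ∀ {u v : Site 2} (p : (discreteDomainGraph Ω δ).Walk u v) {x : ℂ},
      x ∈ range (p.toCurve (meshPoint δ)) → ∃ w ∈ p.support, dist x (meshPoint δ w) ≤ |δ|
  | u, _, SimpleGraph.Walk.nil, x, hx => by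
    rw [range_toCurve_meshPoint_nil, mem_singleton_iff] at hx
    exact ⟨u, by simp, by rw [hx, dist_self]; exact abs_nonneg δ⟩
  | u, _, SimpleGraph.Walk.cons h p, x, hx => by
    rw [range_toCurve_meshPoint_cons, mem_union] at hx
    rcases hx with hx | hx
    · refine ⟨u, by simp, ?_⟩
      have hsub : segment ℝ (meshPoint δ u) (meshPoint δ _) ⊆ Metric.closedBall (meshPoint δ u) |δ| :=
        (convex_closedBall _ _).segment_subset (Metric.mem_closedBall_self (abs_nonneg δ))
          (by rw [Metric.mem_closedBall, dist_comm]; exact (dist_meshPoint_of_discreteDomainGraph_adj h).le)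
      exact Metric.mem_closedBall.1 (hsub hx)
    · obtain ⟨w, hw, hwx⟩ := exists_mem_support_dist_le_of_mem_range_toCurve p hx
      exact ⟨w, by simp [hw], hwx⟩

/-- **The polyline of the past `p[0,n]` of a self-avoiding walk of `Ω_δ` avoids every point at
distance `> |δ|` from the vertices `p_0, …, p_n`** (the support of the past consists of these
vertices, `support_takeUntil_getVert`). [folklore] -/
theorem notMem_range_toCurve_takeUntil_getVert {u v : Site 2}
    {p : (discreteDomainGraph Ω δ).Walk u v} (hp : p.IsPath) {n : ℕ} {x : ℂ}
    (h : ∀ i ≤ n, |δ| < dist x (meshPoint δ (p.getVert i))) :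
    x ∉ range ((p.takeUntil (p.getVert n) (p.getVert_mem_support n)).toCurve (meshPoint δ)) := by
  intro hx
  obtain ⟨w, hw, hwx⟩ := exists_mem_support_dist_le_of_mem_range_toCurve _ hx
  rw [support_takeUntil_getVert hp, List.mem_iff_getElem] at hw
  obtain ⟨i, hi, rfl⟩ := hw
  rw [List.length_take] at hi
  have hin : i ≤ n := by omega
  have hil : i ≤ p.length := by rw [SimpleGraph.Walk.length_support] at hi; omega
  rw [List.getElem_take, ← p.getVert_eq_support_getElem hil] at hwx
  exact (h i hin).not_ge hwx

end Literature.Probability.RandomPlanarGeometry.SAW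

end
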